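import Literature.Probability.Percolation.OneArmEigenfunctions
import Literature.Analysis.SpecialFunctions.JacobiHeatSeries
import Mathlib.Analysis.Calculus.FDeriv.Extend
import HarnessLib

/-!
# Series solutions of LSW's PDE (2.4) with Dirichlet condition at `0` and reflection at `2π`

Topic `Literature/Probability/Percolation`; family `crit-perc`. Real analysis, part of the
analytic half of the discharge of the named fact
`Literature.Probability.Percolation.LawlerSchrammWerner2002_hittingPDE` (`OneArmHittingPDE.lean`;
Lawler–Schramm–Werner (2002), Lemma 2.2, (2.3), (2.12)). With the Dirichlet-branch lift `L` of
`OneArmEigenfunctions.lean` and the Jacobi heat series `Y(z, t) = Σ γ_n e^{-(κ/8) n(n+1) t} y_n(z)`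
of `Literature/Analysis/SpecialFunctions/JacobiHeatSeries.lean` (`c = 3/2 - 2/κ`), the function

  `u(θ, t) = e^{-λ t} (L Y(·, t))(θ) = Σ_n γ_n e^{-λ_n t} φ_n(θ)`,  `λ = (κ² - 16)/(32κ)`,

is, for every `κ > 4` and every coefficient sequence with `γ_n² h_n ≤ G`, a classical solution of
LSW's PDE (2.4) `(κ/2) ∂²_θ u + cot(θ/2) ∂_θ u - ∂ₜ u = 0` on the open strip
`S = (0, 2π) × (0, ∞)`, with explicit continuous partial derivatives, the Dirichlet behaviour
(2.3) at `θ = 0` (`u(0, t) = 0`, `u(θ, t) → 0` as `θ ↓ 0`) and the reflecting behaviour at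
`θ = 2π` (`u(·, t)` has one-sided derivative `0` at `2π`, the content of (2.12)). This is the
analytic input "The theory of diffusion processes … imply that `h(θ, t)` is smooth" of the proof
of Lemma 2.2 (p. 6) for the semigroup of the radial Bessel process killed at `0` and reflected at
`2π`; the particular coefficients `γ_n = ⟨1, φ_n⟩ / ‖φ_n‖²` of the constant initial datum and the
identification with LSW's `h` are the subject of the sequel files. No named fact is introduced.

## Contents

* `lswSeries κ γ`, `lswSeriesDθ`, `lswSeriesDθθ`, `lswSeriesDt` (definitions);
* `hasDerivAt_lswSeries_θ`, `hasDerivAt_lswSeriesDθ_θ`, `hasDerivAt_lswSeries_t`,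
  `lswOp_lswSeries` (the PDE), `continuousOn_lswSeriesDθ/Dθθ/Dt` (on `S`);
* `lswSeries_zero_left`, `tendsto_lswSeries_zero` ((2.3));
  `continuousWithinAt_lswSeries_two_pi`, `exists_bound_lswSeriesDθ`,
  `tendsto_lswSeriesDθ_two_pi`, `hasDerivWithinAt_lswSeries_two_pi` ((2.12) for `u` itself).

## References

* G. F. Lawler, O. Schramm, W. Werner, *One-arm exponent for critical 2D percolation*, Electron.
  J. Probab. 7 (2002), no. 2, §2: Lemma 2.2, (2.3), (2.4), (2.11), (2.12).
  [LawlerSchrammWernerEJP2002]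
-/

noncomputable section

open Real Set Filter
open scoped Topology

namespace Literature.Probability.Percolation

open Literature.Analysis.SpecialFunctions

/-! ### Definitions -/

/-- **The series solution** `u(θ, t) = e^{-λt} sin(θ/4)^q Y(sin²(θ/4), t)`,
`Y = Σ γ_n e^{-(κ/8)n(n+1)t} y_n`, i.e. `u = Σ γ_n e^{-λ_n t} φ_n`.
[cite: LawlerSchrammWernerEJP2002, Lemma 2.2] -/
def lswSeries (κ : ℝ) (γ : ℕ → ℝ) (θ t : ℝ) : ℝ :=
  Real.exp (-(lswLambda κ * t)) *
    lswLift κ (fun z => jacobiHeat (lswJacobiParam κ) (κ / 8) γ z t) θ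

/-- The `θ`-derivative of `lswSeries` (explicit). [folklore] -/
def lswSeriesDθ (κ : ℝ) (γ : ℕ → ℝ) (θ t : ℝ) : ℝ :=
  Real.exp (-(lswLambda κ * t)) *
    lswLiftD κ (fun z => jacobiHeat (lswJacobiParam κ) (κ / 8) γ z t)
      (fun z => jacobiHeatDz (lswJacobiParam κ) (κ / 8) γ z t) θ

/-- The second `θ`-derivative of `lswSeries` (explicit). [folklore] -/
def lswSeriesDθθ (κ : ℝ) (γ : ℕ → ℝ) (θ t : ℝ) : ℝ :=
  Real.exp (-(lswLambda κ * t)) *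
    lswLiftDD κ (fun z => jacobiHeat (lswJacobiParam κ) (κ / 8) γ z t)
      (fun z => jacobiHeatDz (lswJacobiParam κ) (κ / 8) γ z t)
      (fun z => jacobiHeatDzz (lswJacobiParam κ) (κ / 8) γ z t) θ

/-- The `t`-derivative of `lswSeries` (explicit, in the form `Λ u`). [folklore] -/
def lswSeriesDt (κ : ℝ) (γ : ℕ → ℝ) (θ t : ℝ) : ℝ :=
  Real.exp (-(lswLambda κ * t)) *
    lswLiftT κ (fun z => jacobiHeat (lswJacobiParam κ) (κ / 8) γ z t)
      (fun z => jacobiHeatDz (lswJacobiParam κ) (κ / 8) γ z t)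
      (fun z => jacobiHeatDzz (lswJacobiParam κ) (κ / 8) γ z t) θ

/-! ### The change of variables `θ ↦ sin²(θ/4)` -/

/-- `sin²(θ/4) ∈ (0, 1)` for `θ ∈ (0, 2π)`. [folklore] -/
theorem sin_quarter_sq_mem_Ioo {θ : ℝ} (hθ : θ ∈ Ioo 0 (2 * π)) :
    Real.sin (θ / 4) ^ 2 ∈ Ioo (0 : ℝ) 1 := by
  have hs := sin_quarter_pos hθ.1 hθ.2.le
  have hc := cos_quarter_pos hθ.1.le hθ.2
  refine ⟨by positivity, ?_⟩
  nlinarith [Real.sin_sq_add_cos_sq (θ / 4)]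

/-- The change of variables `(θ, t) ↦ (sin²(θ/4), t)` is continuous. [folklore] -/
theorem continuous_sinSqMap :
    Continuous fun p : ℝ × ℝ => (Real.sin (p.1 / 4) ^ 2, p.2) := by fun_prop

/-- … and maps `(0, 2π) × (0, ∞)` into `(0, 1) × (0, ∞)`. [folklore] -/
theorem mapsTo_sinSqMap :
    MapsTo (fun p : ℝ × ℝ => (Real.sin (p.1 / 4) ^ 2, p.2)) (Ioo 0 (2 * π) ×ˢ Ioi 0)
      (Ioo 0 1 ×ˢ Ioi 0) :=
  fun _ hp => ⟨sin_quarter_sq_mem_Ioo hp.1, hp.2⟩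

/-- Continuity on the strip of `(θ, t) ↦ F(sin²(θ/4), t)` for `F` continuous on
`(0, 1) × (0, ∞)`. [folklore] -/
theorem continuousOn_comp_sinSq {F : ℝ × ℝ → ℝ} (hF : ContinuousOn F (Ioo 0 1 ×ˢ Ioi 0)) :
    ContinuousOn (fun p : ℝ × ℝ => F (Real.sin (p.1 / 4) ^ 2, p.2)) (Ioo 0 (2 * π) ×ˢ Ioi 0) :=
  hF.comp continuous_sinSqMap.continuousOn mapsTo_sinSqMap

section Solution

variable {κ G : ℝ} {γ : ℕ → ℝ} (hκ : 4 < κ)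
  (hγ : ∀ n, γ n ^ 2 * hypJacobiNormSq (lswJacobiParam κ) n ≤ G)
include hκ hγ

omit hγ in
/-- `1 < c` for `κ > 4` (abbreviation). [folklore] -/
private theorem hc1 : 1 < lswJacobiParam κ := one_lt_lswJacobiParam hκ
omit hγ in
/-- `c < 2` (abbreviation). [folklore] -/
private theorem hc2' : lswJacobiParam κ < 2 := lswJacobiParam_lt_two (by linarith)
omit hγ in
/-- `0 < κ/8` (abbreviation). [folklore] -/
private theorem hμ : 0 < κ / 8 := by linarith

/-! ### The PDE on the open strip -/

/-- **`∂_θ u = lswSeriesDθ`** on `(0, 2π) × (0, ∞)`. [folklore] -/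
theorem hasDerivAt_lswSeries_θ {θ t : ℝ} (hθ : θ ∈ Ioo 0 (2 * π)) (ht : 0 < t) :
    HasDerivAt (fun x => lswSeries κ γ x t) (lswSeriesDθ κ γ θ t) θ := by
  have hz := sin_quarter_sq_mem_Ioo hθ
  have hY := hasDerivAt_jacobiHeat_z (hc1 hκ) (hc2' hκ) (hμ hκ) hγ hz ht
  exact (hasDerivAt_lswLift (sin_quarter_pos hθ.1 hθ.2.le) hY).const_mul _

/-- **`∂_θ lswSeriesDθ = lswSeriesDθθ`** on `(0, 2π) × (0, ∞)`. [folklore] -/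
theorem hasDerivAt_lswSeriesDθ_θ {θ t : ℝ} (hθ : θ ∈ Ioo 0 (2 * π)) (ht : 0 < t) :
    HasDerivAt (fun x => lswSeriesDθ κ γ x t) (lswSeriesDθθ κ γ θ t) θ := by
  have hz := sin_quarter_sq_mem_Ioo hθ
  have hY := hasDerivAt_jacobiHeat_z (hc1 hκ) (hc2' hκ) (hμ hκ) hγ hz ht
  have hY' := hasDerivAt_jacobiHeatDz_z (hc1 hκ) (hc2' hκ) (hμ hκ) hγ hz ht
  exact (hasDerivAt_lswLiftD (sin_quarter_pos hθ.1 hθ.2.le) hY hY').const_mul _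

/-- **`∂ₜ u = lswSeriesDt`** on `(0, 2π) × (0, ∞)` (product rule and the Jacobi heat equation).
[folklore] -/
theorem hasDerivAt_lswSeries_t {θ t : ℝ} (hθ : θ ∈ Ioo 0 (2 * π)) (ht : 0 < t) :
    HasDerivAt (fun s => lswSeries κ γ θ s) (lswSeriesDt κ γ θ t) t := by
  have hz := sin_quarter_sq_mem_Ioo hθ
  have hY := hasDerivAt_jacobiHeat_t (hc1 hκ) (hc2' hκ) (hμ hκ) hγ ⟨hz.1, hz.2.le⟩ ht
  have hpde := jacobiHeat_pde (hc1 hκ) (hc2' hκ) (hμ hκ) hγ hz ht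
  have h1 : HasDerivAt (fun s : ℝ => -(lswLambda κ * s)) (-lswLambda κ) t :=
    (((hasDerivAt_id t).const_mul (lswLambda κ)).neg).congr_deriv (by simp)
  have h := h1.exp.mul ((hY.const_mul (Real.sin (θ / 4) ^ lswQ κ)))
  refine h.congr_deriv ?_
  simp only [lswSeriesDt, lswLiftT, hpde]
  ring

omit hγ in
/-- **The PDE (2.4)**: `(κ/2) ∂²_θ u + cot(θ/2) ∂_θ u - ∂ₜ u = 0` on `(0, 2π) × (0, ∞)`, in the
tree's notation `lswOp κ θ u_θθ u_θ u_t = 0`. [cite: LawlerSchrammWernerEJP2002, Lemma 2.2, (2.4)] -/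
theorem lswOp_lswSeries {θ t : ℝ} (hθ : θ ∈ Ioo 0 (2 * π)) :
    lswOp κ θ (lswSeriesDθθ κ γ θ t) (lswSeriesDθ κ γ θ t) (lswSeriesDt κ γ θ t) = 0 := by
  unfold lswSeriesDθθ lswSeriesDθ lswSeriesDt
  rw [lswOp_smul, lswOp_lswLift (by linarith) hθ, mul_zero]

/-! ### Continuity of the partial derivatives on the open strip -/

omit hκ hγ in
/-- The elementary factors are continuous on the strip (where `sin(θ/4) ≠ 0`). [folklore] -/
theorem continuousOn_factors (κ : ℝ) :
    ContinuousOn (fun p : ℝ × ℝ => Real.sin (p.1 / 4) ^ lswQ κ) (Ioo 0 (2 * π) ×ˢ Ioi 0) ∧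
    (∀ p ∈ Ioo 0 (2 * π) ×ˢ Ioi (0 : ℝ), Real.sin (p.1 / 4) ≠ 0) := by
  have hsin : ∀ p ∈ Ioo 0 (2 * π) ×ˢ Ioi (0 : ℝ), Real.sin (p.1 / 4) ≠ 0 :=
    fun p hp => (sin_quarter_pos hp.1.1 hp.1.2.le).ne'
  exact ⟨ContinuousOn.rpow_const (by fun_prop) fun p hp => Or.inl (hsin p hp), hsin⟩

/-- **`∂_θ u` is continuous on the open strip.** [folklore] -/
theorem continuousOn_lswSeriesDθ :
    ContinuousOn (fun p : ℝ × ℝ => lswSeriesDθ κ γ p.1 p.2) (Ioo 0 (2 * π) ×ˢ Ioi 0) := by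
  have hY := continuousOn_comp_sinSq
    ((continuousOn_jacobiHeat' (hc1 hκ) (hc2' hκ) (hμ hκ) hγ).mono
      (prod_mono Ioo_subset_Ioc_self Subset.rfl))
  have hYz := continuousOn_comp_sinSq (continuousOn_jacobiHeatDz' (hc1 hκ) (hc2' hκ) (hμ hκ) hγ)
  obtain ⟨hS, hsin⟩ := continuousOn_factors κ
  have hE : ContinuousOn (fun p : ℝ × ℝ => Real.exp (-(lswLambda κ * p.2))) (Ioo 0 (2 * π) ×ˢ Ioi 0) :=
    Continuous.continuousOn (by fun_prop)
  have hs' : ContinuousOn (fun p : ℝ × ℝ => Real.sin (p.1 / 4)) (Ioo 0 (2 * π) ×ˢ Ioi 0) :=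
    Continuous.continuousOn (by fun_prop)
  have hc' : ContinuousOn (fun p : ℝ × ℝ => Real.cos (p.1 / 4)) (Ioo 0 (2 * π) ×ˢ Ioi 0) :=
    Continuous.continuousOn (by fun_prop)
  have h1 : ContinuousOn (fun p : ℝ × ℝ => lswQ κ * Real.sin (p.1 / 4) ^ lswQ κ * Real.cos (p.1 / 4)
      / (4 * Real.sin (p.1 / 4))) (Ioo 0 (2 * π) ×ˢ Ioi 0) :=
    ((continuousOn_const.mul hS).mul hc').div (continuousOn_const.mul hs')
      fun p hp => mul_ne_zero (by norm_num) (hsin p hp)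
  have h2 : ContinuousOn (fun p : ℝ × ℝ => Real.sin (p.1 / 4) * Real.cos (p.1 / 4) / 2)
      (Ioo 0 (2 * π) ×ˢ Ioi 0) := (hs'.mul hc').div_const 2
  exact hE.mul ((h1.mul hY).add ((hS.mul hYz).mul h2))

/-- **`∂²_θ u` is continuous on the open strip.** [folklore] -/
theorem continuousOn_lswSeriesDθθ :
    ContinuousOn (fun p : ℝ × ℝ => lswSeriesDθθ κ γ p.1 p.2) (Ioo 0 (2 * π) ×ˢ Ioi 0) := by
  have hY := continuousOn_comp_sinSq
    ((continuousOn_jacobiHeat' (hc1 hκ) (hc2' hκ) (hμ hκ) hγ).mono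
      (prod_mono Ioo_subset_Ioc_self Subset.rfl))
  have hYz := continuousOn_comp_sinSq (continuousOn_jacobiHeatDz' (hc1 hκ) (hc2' hκ) (hμ hκ) hγ)
  have hYzz := continuousOn_comp_sinSq (continuousOn_jacobiHeatDzz' (hc1 hκ) (hc2' hκ) (hμ hκ) hγ)
  obtain ⟨hS, hsin⟩ := continuousOn_factors κ
  have hE : ContinuousOn (fun p : ℝ × ℝ => Real.exp (-(lswLambda κ * p.2))) (Ioo 0 (2 * π) ×ˢ Ioi 0) :=
    Continuous.continuousOn (by fun_prop)
  have hs' : ContinuousOn (fun p : ℝ × ℝ => Real.sin (p.1 / 4)) (Ioo 0 (2 * π) ×ˢ Ioi 0) :=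
    Continuous.continuousOn (by fun_prop)
  have hc' : ContinuousOn (fun p : ℝ × ℝ => Real.cos (p.1 / 4)) (Ioo 0 (2 * π) ×ˢ Ioi 0) :=
    Continuous.continuousOn (by fun_prop)
  have h1 : ContinuousOn (fun p : ℝ × ℝ => lswQ κ * Real.sin (p.1 / 4) ^ lswQ κ
      * (lswQ κ * (1 - Real.sin (p.1 / 4) ^ 2) - 1) / (16 * Real.sin (p.1 / 4) ^ 2))
      (Ioo 0 (2 * π) ×ˢ Ioi 0) :=
    ((continuousOn_const.mul hS).mul ((continuousOn_const.mul (continuousOn_const.sub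
      (hs'.pow 2))).sub continuousOn_const)).div (continuousOn_const.mul (hs'.pow 2))
      fun p hp => mul_ne_zero (by norm_num) (pow_ne_zero _ (hsin p hp))
  have h2 : ContinuousOn (fun p : ℝ × ℝ => lswQ κ * Real.sin (p.1 / 4) ^ lswQ κ
      * Real.cos (p.1 / 4) ^ 2 / 4) (Ioo 0 (2 * π) ×ˢ Ioi 0) :=
    ((continuousOn_const.mul hS).mul (hc'.pow 2)).div_const 4
  have h3 : ContinuousOn (fun p : ℝ × ℝ => Real.sin (p.1 / 4) ^ 2 * Real.cos (p.1 / 4) ^ 2 / 4)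
      (Ioo 0 (2 * π) ×ˢ Ioi 0) := ((hs'.pow 2).mul (hc'.pow 2)).div_const 4
  have h4 : ContinuousOn (fun p : ℝ × ℝ => (1 - 2 * Real.sin (p.1 / 4) ^ 2) / 8)
      (Ioo 0 (2 * π) ×ˢ Ioi 0) :=
    (continuousOn_const.sub (continuousOn_const.mul (hs'.pow 2))).div_const 8
  exact hE.mul ((((h1.mul hY).add (h2.mul hYz)).add ((hS.mul hYzz).mul h3)).add ((hS.mul hYz).mul h4))

/-- **`∂ₜ u` is continuous on the open strip.** [folklore] -/
theorem continuousOn_lswSeriesDt :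
    ContinuousOn (fun p : ℝ × ℝ => lswSeriesDt κ γ p.1 p.2) (Ioo 0 (2 * π) ×ˢ Ioi 0) := by
  have hY := continuousOn_comp_sinSq
    ((continuousOn_jacobiHeat' (hc1 hκ) (hc2' hκ) (hμ hκ) hγ).mono
      (prod_mono Ioo_subset_Ioc_self Subset.rfl))
  have hYz := continuousOn_comp_sinSq (continuousOn_jacobiHeatDz' (hc1 hκ) (hc2' hκ) (hμ hκ) hγ)
  have hYzz := continuousOn_comp_sinSq (continuousOn_jacobiHeatDzz' (hc1 hκ) (hc2' hκ) (hμ hκ) hγ)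
  obtain ⟨hS, -⟩ := continuousOn_factors κ
  have hE : ContinuousOn (fun p : ℝ × ℝ => Real.exp (-(lswLambda κ * p.2))) (Ioo 0 (2 * π) ×ˢ Ioi 0) :=
    Continuous.continuousOn (by fun_prop)
  have hs' : ContinuousOn (fun p : ℝ × ℝ => Real.sin (p.1 / 4)) (Ioo 0 (2 * π) ×ˢ Ioi 0) :=
    Continuous.continuousOn (by fun_prop)
  have h1 : ContinuousOn (fun p : ℝ × ℝ => Real.sin (p.1 / 4) ^ 2 * (1 - Real.sin (p.1 / 4) ^ 2))
      (Ioo 0 (2 * π) ×ˢ Ioi 0) := (hs'.pow 2).mul (continuousOn_const.sub (hs'.pow 2))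
  have h2 : ContinuousOn (fun p : ℝ × ℝ => lswJacobiParam κ - 2 * Real.sin (p.1 / 4) ^ 2)
      (Ioo 0 (2 * π) ×ˢ Ioi 0) := continuousOn_const.sub (continuousOn_const.mul (hs'.pow 2))
  exact hE.mul (hS.mul ((continuousOn_const.mul ((h1.mul hYzz).add (h2.mul hYz))).sub
    (continuousOn_const.mul hY)))

/-! ### The Dirichlet condition (2.3) at `θ = 0` -/

omit hγ in
/-- `u(0, t) = 0`. [cite: LawlerSchrammWernerEJP2002, (2.3)] -/
theorem lswSeries_zero_left (t : ℝ) : lswSeries κ γ 0 t = 0 := by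
  rw [lswSeries, lswLift_zero_left hκ, mul_zero]

/-- **(2.3): `u(θ, t) → 0` as `θ ↓ 0`** (`t > 0`): `|u| ≤ C e^{-λt} sin(θ/4)^{q + (1-c)} → 0` since
`q/2 + (1-c)/2 = (c-1)/2 > 0` (`q = 2(c - 1)`). [cite: LawlerSchrammWernerEJP2002, (2.3)] -/
theorem tendsto_lswSeries_zero {t : ℝ} (ht : 0 < t) :
    Tendsto (fun θ => lswSeries κ γ θ t) (𝓝[>] 0) (𝓝 0) := by
  obtain ⟨C, hC0, hC⟩ := exists_abs_jacobiHeat_le_near_zero (hc1 hκ) (hc2' hκ) (hμ hκ) hγ ht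
  have hq : lswQ κ = 2 * (lswJacobiParam κ - 1) := by
    unfold lswQ lswJacobiParam; field_simp; ring
  set e := lswJacobiParam κ - 1 with he
  have he0 : 0 < e := by have := hc1 hκ; rw [he]; linarith
  -- the bound on `(0, π]`
  have hbound : ∀ θ ∈ Ioc (0 : ℝ) π,
      |lswSeries κ γ θ t| ≤ Real.exp (-(lswLambda κ * t)) * C * Real.sin (θ / 4) ^ e := by
    intro θ hθ
    have hs : 0 < Real.sin (θ / 4) :=
      Real.sin_pos_of_pos_of_lt_pi (by linarith [hθ.1]) (by linarith [hθ.2, Real.pi_pos])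
    have hs2 : Real.sin (θ / 4) ^ 2 ≤ 1 / 2 := by
      have h1 : Real.sin (θ / 4) ≤ Real.sin (π / 4) :=
        Real.sin_le_sin_of_le_of_le_pi_div_two (by linarith [hθ.1, Real.pi_pos])
          (by linarith [Real.pi_pos]) (by linarith [hθ.2])
      rw [Real.sin_pi_div_four] at h1
      have h2 : Real.sin (θ / 4) ^ 2 ≤ (Real.sqrt 2 / 2) ^ 2 := pow_le_pow_left₀ hs.le h1 2
      rw [div_pow, Real.sq_sqrt (by norm_num)] at h2
      linarith
    have hz : Real.sin (θ / 4) ^ 2 ∈ Ioc (0 : ℝ) (1 / 2) := ⟨by positivity, hs2⟩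
    have hY := hC _ hz t le_rfl
    rw [lswSeries, lswLift, abs_mul, abs_of_pos (Real.exp_pos _), abs_mul,
      abs_of_nonneg (Real.rpow_nonneg hs.le _), mul_assoc]
    refine mul_le_mul_of_nonneg_left ?_ (Real.exp_pos _).le
    calc Real.sin (θ / 4) ^ lswQ κ * |jacobiHeat (lswJacobiParam κ) (κ / 8) γ
            (Real.sin (θ / 4) ^ 2) t|
          ≤ Real.sin (θ / 4) ^ lswQ κ * (C * (Real.sin (θ / 4) ^ 2) ^ ((1 - lswJacobiParam κ) / 2)) :=
            mul_le_mul_of_nonneg_left hY (Real.rpow_nonneg hs.le _)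
      _ = C * Real.sin (θ / 4) ^ e := by
            rw [← Real.rpow_natCast, ← Real.rpow_mul hs.le, hq]
            rw [show ((2 : ℕ) : ℝ) * ((1 - lswJacobiParam κ) / 2) = -e by rw [he]; push_cast; ring,
              show 2 * (lswJacobiParam κ - 1) = e + e by rw [he]; ring,
              Real.rpow_add hs, Real.rpow_neg hs.le]
            field_simp
  -- squeeze
  have hlim : Tendsto (fun θ : ℝ => Real.exp (-(lswLambda κ * t)) * C * Real.sin (θ / 4) ^ e)
      (𝓝[>] 0) (𝓝 0) := by
    have h1 : Tendsto (fun θ : ℝ => Real.sin (θ / 4)) (𝓝[>] 0) (𝓝[>] 0) := by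
      refine tendsto_nhdsWithin_iff.2 ⟨?_, ?_⟩
      · have : Tendsto (fun θ : ℝ => Real.sin (θ / 4)) (𝓝 0) (𝓝 0) := by
          have h := (by fun_prop : Continuous fun θ : ℝ => Real.sin (θ / 4)).tendsto 0
          rwa [zero_div, Real.sin_zero] at h
        exact this.mono_left nhdsWithin_le_nhds
      · filter_upwards [Ioo_mem_nhdsGT (show (0 : ℝ) < π by positivity)] with θ hθ
        exact Real.sin_pos_of_pos_of_lt_pi (by linarith [hθ.1]) (by linarith [hθ.2, Real.pi_pos])
    have h2 : Tendsto (fun s : ℝ => s ^ e) (𝓝[>] 0) (𝓝 0) := by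
      have := (Real.continuousAt_rpow_const 0 e (Or.inr he0.le)).tendsto
      rw [Real.zero_rpow he0.ne'] at this
      exact this.mono_left nhdsWithin_le_nhds
    simpa using (h2.comp h1).const_mul (Real.exp (-(lswLambda κ * t)) * C)
  refine squeeze_zero_norm' ?_ hlim
  filter_upwards [Ioc_mem_nhdsGT Real.pi_pos] with θ hθ
  rw [Real.norm_eq_abs]
  exact hbound θ hθ

/-! ### The reflecting condition at `θ = 2π` -/

/-- `u(·, t)` is continuous at `2π` from the left (`t > 0`). [folklore] -/
theorem continuousWithinAt_lswSeries_two_pi {t : ℝ} (ht : 0 < t) :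
    ContinuousWithinAt (fun θ => lswSeries κ γ θ t) (Ioo π (2 * π)) (2 * π) := by
  have hcont := continuousOn_jacobiHeat (hc1 hκ) (hc2' hκ) (hμ hκ) hγ (a := 1 / 2)
    (by norm_num) (by norm_num) ht
  -- `z ↦ Y(z, t)` is continuous on `[1/2, 1]`
  have hYz : ContinuousOn (fun z => jacobiHeat (lswJacobiParam κ) (κ / 8) γ z t) (Icc (1 / 2) 1) :=
    hcont.comp (Continuous.prodMk_left t).continuousOn fun z hz => ⟨hz, Set.mem_Ici.2 le_rfl⟩
  have hmap : MapsTo (fun θ : ℝ => Real.sin (θ / 4) ^ 2) (Icc π (2 * π)) (Icc (1 / 2) 1) := by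
    intro θ hθ
    have h1 : Real.sin (π / 4) ≤ Real.sin (θ / 4) :=
      Real.sin_le_sin_of_le_of_le_pi_div_two (by linarith [Real.pi_pos])
        (by linarith [hθ.2]) (by linarith [hθ.1])
    rw [Real.sin_pi_div_four] at h1
    have hs0 : 0 ≤ Real.sqrt 2 / 2 := by positivity
    have h2 : (Real.sqrt 2 / 2) ^ 2 ≤ Real.sin (θ / 4) ^ 2 := pow_le_pow_left₀ hs0 h1 2
    rw [div_pow, Real.sq_sqrt (by norm_num)] at h2
    exact ⟨by linarith, by nlinarith [Real.sin_sq_add_cos_sq (θ / 4)]⟩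
  have hcomp : ContinuousOn (fun θ => lswSeries κ γ θ t) (Icc π (2 * π)) := by
    unfold lswSeries lswLift
    refine ContinuousOn.mul continuousOn_const (ContinuousOn.mul ?_ ?_)
    · exact ContinuousOn.rpow_const (by fun_prop) fun θ hθ =>
        Or.inr (lswQ_pos hκ).le
    · exact hYz.comp (by fun_prop) hmap
  exact (hcomp.continuousWithinAt ⟨by linarith [Real.pi_pos], le_rfl⟩).mono Ioo_subset_Icc_self

/-- **Uniform bound for `∂_θ u` near `2π`**: for `t₀ > 0` there is `M ≥ 0` with
`|∂_θ u(θ, t)| ≤ M cos(θ/4)` for `θ ∈ (π, 2π)`, `t ≥ t₀` (`∂_θ u` carries the factor `cos(θ/4)`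
and `Y, ∂_z Y` are bounded up to `z = 1`, uniformly in `t ≥ t₀`). [folklore] -/
theorem exists_bound_lswSeriesDθ {t₀ : ℝ} (ht₀ : 0 < t₀) :
    ∃ M : ℝ, 0 ≤ M ∧ ∀ θ ∈ Ioo π (2 * π), ∀ t, t₀ ≤ t →
      |lswSeriesDθ κ γ θ t| ≤ M * Real.cos (θ / 4) := by
  obtain ⟨C₁, hC₁⟩ := exists_bound_jacobiHeat (hc1 hκ) (hc2' hκ) (hμ hκ) hγ (a := 1 / 2)
    (by norm_num) (by norm_num) ht₀
  obtain ⟨C₂, hC₂⟩ := exists_bound_jacobiHeatDz (hc1 hκ) (hc2' hκ) (hμ hκ) hγ (a := 1 / 2)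
    (by norm_num) (by norm_num) ht₀
  have hq0 := (lswQ_pos hκ).le
  refine ⟨lswQ κ / (4 * (Real.sqrt 2 / 2)) * |C₁| + |C₂| / 2, by positivity, fun θ hθ t ht => ?_⟩
  set E := Real.exp (-(lswLambda κ * t)) with hE
  have hE1 : E ≤ 1 := by
    rw [hE, Real.exp_le_one_iff]
    have := mul_nonneg (lswLambda_pos hκ).le (ht₀.le.trans ht)
    linarith
  have hs : 0 < Real.sin (θ / 4) := sin_quarter_pos (by linarith [hθ.1, Real.pi_pos]) hθ.2.le
  have hco : 0 < Real.cos (θ / 4) := cos_quarter_pos (by linarith [hθ.1, Real.pi_pos]) hθ.2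
  have hs1 : Real.sin (θ / 4) ≤ 1 := Real.sin_le_one _
  have hslow : Real.sqrt 2 / 2 ≤ Real.sin (θ / 4) := by
    have := Real.sin_le_sin_of_le_of_le_pi_div_two (x := π / 4) (y := θ / 4)
      (by linarith [Real.pi_pos]) (by linarith [hθ.2]) (by linarith [hθ.1])
    rwa [Real.sin_pi_div_four] at this
  have hz : Real.sin (θ / 4) ^ 2 ∈ Ico (1 / 2 : ℝ) 1 := by
    refine ⟨?_, (sin_quarter_sq_mem_Ioo ⟨by linarith [hθ.1, Real.pi_pos], hθ.2⟩).2⟩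
    have h2 : (Real.sqrt 2 / 2) ^ 2 ≤ Real.sin (θ / 4) ^ 2 := pow_le_pow_left₀ (by positivity) hslow 2
    rw [div_pow, Real.sq_sqrt (by norm_num)] at h2
    linarith
  have hY := hC₁ _ ⟨hz.1, hz.2.le⟩ t ht
  have hYz := hC₂ _ hz t ht
  have hSq : 0 ≤ Real.sin (θ / 4) ^ lswQ κ := Real.rpow_nonneg hs.le _
  have hSq1 : Real.sin (θ / 4) ^ lswQ κ ≤ 1 := Real.rpow_le_one hs.le hs1 (lswQ_pos hκ).le
  have hA : |lswQ κ * Real.sin (θ / 4) ^ lswQ κ * Real.cos (θ / 4) / (4 * Real.sin (θ / 4))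
      * jacobiHeat (lswJacobiParam κ) (κ / 8) γ (Real.sin (θ / 4) ^ 2) t|
      ≤ lswQ κ / (4 * (Real.sqrt 2 / 2)) * |C₁| * Real.cos (θ / 4) := by
    rw [abs_mul]
    have h1 : |lswQ κ * Real.sin (θ / 4) ^ lswQ κ * Real.cos (θ / 4) / (4 * Real.sin (θ / 4))|
        ≤ lswQ κ / (4 * (Real.sqrt 2 / 2)) * Real.cos (θ / 4) := by
      rw [abs_of_nonneg (by positivity)]
      rw [div_le_iff₀ (by positivity)]
      calc lswQ κ * Real.sin (θ / 4) ^ lswQ κ * Real.cos (θ / 4)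
            ≤ lswQ κ * 1 * Real.cos (θ / 4) := by gcongr
        _ ≤ lswQ κ / (4 * (Real.sqrt 2 / 2)) * Real.cos (θ / 4) * (4 * Real.sin (θ / 4)) := by
            rw [mul_one]
            have : lswQ κ * Real.cos (θ / 4) = lswQ κ / (4 * (Real.sqrt 2 / 2)) * Real.cos (θ / 4)
                * (4 * (Real.sqrt 2 / 2)) := by field_simp
            rw [this]
            gcongr
    calc _ ≤ (lswQ κ / (4 * (Real.sqrt 2 / 2)) * Real.cos (θ / 4)) * |C₁| :=
          mul_le_mul h1 (hY.trans (le_abs_self _)) (abs_nonneg _) (by positivity)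
      _ = _ := by ring
  have hB : |Real.sin (θ / 4) ^ lswQ κ * jacobiHeatDz (lswJacobiParam κ) (κ / 8) γ
        (Real.sin (θ / 4) ^ 2) t * (Real.sin (θ / 4) * Real.cos (θ / 4) / 2)|
      ≤ |C₂| / 2 * Real.cos (θ / 4) := by
    rw [abs_mul, abs_mul, abs_of_nonneg hSq, abs_of_nonneg (by positivity :
      (0 : ℝ) ≤ Real.sin (θ / 4) * Real.cos (θ / 4) / 2)]
    have step1 : Real.sin (θ / 4) ^ lswQ κ * |jacobiHeatDz (lswJacobiParam κ) (κ / 8) γ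
        (Real.sin (θ / 4) ^ 2) t| ≤ 1 * |C₂| :=
      mul_le_mul hSq1 (hYz.trans (le_abs_self _)) (abs_nonneg _) zero_le_one
    have step2 : Real.sin (θ / 4) * Real.cos (θ / 4) / 2 ≤ 1 * Real.cos (θ / 4) / 2 :=
      div_le_div_of_nonneg_right (mul_le_mul_of_nonneg_right hs1 hco.le) (by norm_num)
    calc _ ≤ (1 * |C₂|) * (1 * Real.cos (θ / 4) / 2) :=
          mul_le_mul step1 step2 (by positivity) (by positivity)
      _ = |C₂| / 2 * Real.cos (θ / 4) := by ring
  rw [lswSeriesDθ, lswLiftD, abs_mul, abs_of_pos (Real.exp_pos _)]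
  have hsum : |lswQ κ * Real.sin (θ / 4) ^ lswQ κ * Real.cos (θ / 4) / (4 * Real.sin (θ / 4))
        * jacobiHeat (lswJacobiParam κ) (κ / 8) γ (Real.sin (θ / 4) ^ 2) t
      + Real.sin (θ / 4) ^ lswQ κ * jacobiHeatDz (lswJacobiParam κ) (κ / 8) γ
        (Real.sin (θ / 4) ^ 2) t * (Real.sin (θ / 4) * Real.cos (θ / 4) / 2)|
      ≤ (lswQ κ / (4 * (Real.sqrt 2 / 2)) * |C₁| + |C₂| / 2) * Real.cos (θ / 4) := by
    calc _ ≤ _ := abs_add_le _ _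
      _ ≤ lswQ κ / (4 * (Real.sqrt 2 / 2)) * |C₁| * Real.cos (θ / 4) + |C₂| / 2 * Real.cos (θ / 4) :=
          add_le_add hA hB
      _ = _ := by ring
  calc _ ≤ 1 * ((lswQ κ / (4 * (Real.sqrt 2 / 2)) * |C₁| + |C₂| / 2) * Real.cos (θ / 4)) :=
        mul_le_mul hE1 hsum (abs_nonneg _) zero_le_one
    _ = _ := one_mul _

/-- **`∂_θ u(θ, t) → 0` as `θ ↑ 2π`** (`t > 0`). [cite: LawlerSchrammWernerEJP2002, (2.12)] -/
theorem tendsto_lswSeriesDθ_two_pi {t : ℝ} (ht : 0 < t) :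
    Tendsto (fun θ => lswSeriesDθ κ γ θ t) (𝓝[<] (2 * π)) (𝓝 0) := by
  obtain ⟨M, hM0, hbound⟩ := exists_bound_lswSeriesDθ hκ hγ ht
  have hcos : Tendsto (fun θ : ℝ => M * Real.cos (θ / 4)) (𝓝[<] (2 * π)) (𝓝 0) := by
    have : Tendsto (fun θ : ℝ => M * Real.cos (θ / 4)) (𝓝 (2 * π)) (𝓝 (M * Real.cos (2 * π / 4))) :=
      ((Real.continuous_cos.comp (continuous_id.div_const (4 : ℝ))).tendsto (2 * π)).const_mul M
    rw [show 2 * π / 4 = π / 2 by ring, Real.cos_pi_div_two, mul_zero] at this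
    exact this.mono_left nhdsWithin_le_nhds
  refine squeeze_zero_norm' ?_ hcos
  filter_upwards [Ioo_mem_nhdsLT (by linarith [Real.pi_pos] : π < 2 * π)] with θ hθ
  rw [Real.norm_eq_abs]
  exact hbound θ hθ t le_rfl

/-- **The reflecting condition at `2π` for `u` itself**: `θ ↦ u(θ, t)` has one-sided derivative
`0` at `θ = 2π` from the left (`t > 0`). [cite: LawlerSchrammWernerEJP2002, Lemma 2.3, (2.12)] -/
theorem hasDerivWithinAt_lswSeries_two_pi {t : ℝ} (ht : 0 < t) :
    HasDerivWithinAt (fun θ => lswSeries κ γ θ t) 0 (Iic (2 * π)) (2 * π) := by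
  have hsub : Ioo π (2 * π) ⊆ Ioo 0 (2 * π) := fun θ hθ => ⟨by linarith [hθ.1, Real.pi_pos], hθ.2⟩
  have hdiff : DifferentiableOn ℝ (fun θ => lswSeries κ γ θ t) (Ioo π (2 * π)) :=
    fun θ hθ => (hasDerivAt_lswSeries_θ hκ hγ (hsub hθ) ht).differentiableAt.differentiableWithinAt
  have hmem : Ioo π (2 * π) ∈ 𝓝[<] (2 * π) := Ioo_mem_nhdsLT (by linarith [Real.pi_pos])
  refine hasDerivWithinAt_Iic_of_tendsto_deriv hdiff
    (continuousWithinAt_lswSeries_two_pi hκ hγ ht) hmem ?_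
  refine (tendsto_lswSeriesDθ_two_pi hκ hγ ht).congr' ?_
  filter_upwards [hmem] with θ hθ
  exact ((hasDerivAt_lswSeries_θ hκ hγ (hsub hθ) ht).deriv).symm

end Solution

end Literature.Probability.Percolation
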